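import Summits.CriticalPhenomena.PercolationContinuityZ3.Theorems.Transplant.PlanarCells2Defs
import HarnessLib

/-!
# N2 (frames-only node `SamePDropOfSkeletonFrm₁`, OPEN), Geom foundation under (R-22): TWO-UNIT PLANAR CELLS WITH STAGGERED CENTRES `PCells2S`
# (= `PCells2` + a transverse creep `c i ∈ [0, cmax]` per unit macro-step along axis `i`, `cmax ≤ r_j`), the staggered centre `cenS`, and the
# box family of `PlanarCells2Defs` VERBATIM about `cenS` (same names, same intervals)

builds on p205010 (kernel theorem, internal audit signed; external expert review pending) — nothing in this file uses p205010; nothing here is a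
claim about the open node `SamePDropOfSkeletonFrm₁`.
Lane `prim-bschramm`, seat `prim-bschramm-p5` (gen 15; (C) lineage); FOUNDATION file of ruling (R-22) (design owner p3-g15, 2026-08-22T19:08Z; lead
19:11Z): under orientation the (C) corridor is [E-run] ⧺ [v-parking] ⧺ [u-parking] and the parking displaces the certified region toward the onward
quadrant by a deterministic creep per macro-step (B9 LEMMA, HOME/prim-bschramm-p5-g15/B9-CORRIDOR-BOX.md §2/§A3), so the cubes and the cells live
on the staggered lattice `Λ′ = ℤ·(20r₀, c 0) + ℤ·(c 1, 20r₁)` (fine units; `c i` = the creep of a unit step ALONG axis `i`, felt on the OTHER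
coordinate, toward the onward quadrant: `0 ≤ c i`).  helper file (`--supports stmt-CriticalPhenomena-4575`).

WHAT CHANGES w.r.t. `PCells2` (PlanarCells2Defs): ONLY the centre.  `cenS v j := 20·r_j·v j + c (oth j)·v (oth j)`; along the step axis the centre
moves by `20 r` exactly as before (`cenS_add_stepVec_fst`); ACROSS it the centre creeps: `cenS_add_stepVec_oth : cenS (v + stepVec δ) (oth δ.1) =
cenS v (oth δ.1) + sgOf δ · c δ.1` (PCells2's :113 has no creep — its ≈ 17 consumers on N2's path are re-based on this lemma by the Geom pen, stmt);
coordinatewise separation (`cen_gap`/`cen_cases`) is replaced by the 2D separation `cenS_sep : u ≠ v → ∃ j, 20·r_j − cmax ≤ |cenS v j − cenS u j|`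
(the coordinate with the larger index gap wins).  Every box (`Q M Cell Btw Efar Ewv Stub Zone Face Hfull BtwN EfarN EwvN farAN farAS lev faceLo faceHi
probeWorldN`) is the SAME interval about `cenS`, under the SAME name in namespace `PCells2S`, so a consumer re-bases by `(P : PCells2) ↦ (P : PCells2S)`
and `cen ↦ cenS`.  CORNER ITEM ((R-22) (3), typer's choice, recorded here): `Cell` keeps half-width `10 r`; the cells of DIAGONAL neighbours `v` and
`v + e₀ − e₁` then overlap in a `c 1 × c 0` corner — harmless because no `SepGeom` field compares two cells (Q/Q, Q/Btw, Btw/Btw, Q/Efar, Btw/Efar,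
Ewv/Efar, Cell/Q, Zone/Q all keep clearance `≥ 20r − cmax − 15r ≥ 4r`); `Cell` is to be used only through those facts and the re-cut containments
`Btw ⊆ Cell ∪ Cell′` about the staggered neighbour.
* §1 `PCells2S`, `cenS`, `cenS_apply/zero/congr`, **`cenS_add_stepVec_fst`**, **`cenS_add_stepVec_oth`**, **`cenS_sep`**, `cenS_eq_cen_of_zero`;
* §2 the box family about `cenS` (verbatim intervals), `mem_aboxS_iff`, `Icc_faceLo_faceHi`.
[cite: KozmaNitzan2024, §4 pp. 25–26 (Q_v, M_v, E_{v,x}, H^j_{v,x}), p. 30 (F^j_{v,x})]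
-/

noncomputable section

namespace Summit.CriticalPhenomena.PercolationContinuityZ3.Theorems

namespace Transplant

open Literature.Probability.Percolation Literature.Probability.LatticeModels SimpleGraph GadgetSystem Contour
open Literature.Probability.Percolation.KozmaNitzan
open Literature.Probability.Percolation.KozmaNitzan.Cells (oth oth_ne sgOf sgOf_sign stepVec_apply_fst stepVec_apply_oth eq_oth_of_ne oth_oth
  eq_of_coords)
open PCells (mem_psBox_iff)

/-! ## §1 Staggered two-unit cells and their centres -/

/-- **Two-unit planar cells with staggered centres**: `PCells2` plus the creep `c i` of a unit macro-step along axis `i` (felt on the other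
coordinate, toward the onward quadrant), `0 ≤ c i ≤ cmax ≤ r_j`. [this work] -/
structure PCells2S extends PCells2 where
  /-- the creep of a unit step along axis `i`, felt on the other coordinate -/
  c : Fin 2 → ℤ
  /-- the creep bound -/
  cmax : ℕ
  /-- the creep points toward the onward quadrant -/
  hc0 : ∀ i, 0 ≤ c i
  /-- the creep is at most `cmax` -/
  hcm : ∀ i, c i ≤ cmax
  /-- `cmax` is at most each unit -/
  hcr : ∀ j, cmax ≤ toPCells2.r j

namespace PCells2S

variable (P : PCells2S)

/-- The staggered centre: `cenS v j = 20·r_j·v j + c (oth j)·v (oth j)`. [this work] -/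
def cenS (v : Site 2) : Site 2 := fun j => 20 * (P.r j : ℤ) * v j + P.c (oth j) * v (oth j)

/-- The staggered centre, coordinatewise. [folklore] -/
@[simp] theorem cenS_apply (v : Site 2) (j : Fin 2) : P.cenS v j = 20 * (P.r j : ℤ) * v j + P.c (oth j) * v (oth j) := rfl

/-- `cenS 0 = 0`. [folklore] -/
@[simp] theorem cenS_zero : P.cenS 0 = 0 := by funext j; simp

/-- Equal macro-vertices have equal centres (congruence in both coordinates). [folklore] -/
theorem cenS_congr {u v : Site 2} (h : u = v) : P.cenS u = P.cenS v := by rw [h]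

/-- With zero creep the staggered centre is `PCells2`'s centre. [folklore] -/
theorem cenS_eq_cen_of_zero (h : ∀ i, P.c i = 0) (v : Site 2) : P.cenS v = P.toPCells2.cen v := by
  funext j; simp [cenS_apply, h]

/-- `|c i| ≤ cmax`. [folklore] -/
theorem abs_c_le (i : Fin 2) : |P.c i| ≤ (P.cmax : ℤ) := abs_le.2 ⟨by linarith [P.hc0 i], P.hcm i⟩

/-- **Along the step axis the centre moves by `20 r`** — `PCells2.cen_add_stepVec_fst`'s statement for the staggered centre. [folklore] -/
theorem cenS_add_stepVec_fst (v : Site 2) (δ : MDir) :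
    PCells2S.cenS P (v + stepVec δ) δ.1 = PCells2S.cenS P v δ.1 + sgOf δ * (20 * (P.r δ.1 : ℤ)) := by
  simp only [cenS_apply, Pi.add_apply, stepVec_apply_fst, stepVec_apply_oth, add_zero]; ring

/-- **Across the step axis the centre CREEPS by `sgOf δ · c δ.1`** (for `PCells2` it does not move, PlanarCells2Defs :113). [this work] -/
theorem cenS_add_stepVec_oth (v : Site 2) (δ : MDir) :
    PCells2S.cenS P (v + stepVec δ) (oth δ.1) = PCells2S.cenS P v (oth δ.1) + sgOf δ * P.c δ.1 := by
  simp only [cenS_apply, Pi.add_apply, stepVec_apply_oth, add_zero, oth_oth, stepVec_apply_fst]; ring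

/-- **2D separation of staggered centres**: distinct macro-vertices have, in the coordinate `j` with the larger index gap, centres at distance at
least `20 r_j − cmax` (`≥ 19 r_j`). [this work] -/
theorem cenS_sep {u v : Site 2} (h : u ≠ v) : ∃ j : Fin 2, 20 * (P.r j : ℤ) - P.cmax ≤ |P.cenS v j - P.cenS u j| := by
  have hne : ∃ j : Fin 2, u j ≠ v j := by
    by_contra hall
    push Not at hall
    exact h (funext fun j => hall j)
  set g0 : ℤ := v 0 - u 0 with hg0
  set g1 : ℤ := v 1 - u 1 with hg1
  have h01 : oth (0 : Fin 2) = 1 := by decide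
  have h10 : oth (1 : Fin 2) = 0 := by decide
  have hc1 := P.abs_c_le 1
  have hc0 := P.abs_c_le 0
  have hr0 : (P.cmax : ℤ) ≤ P.r 0 := by exact_mod_cast P.hcr 0
  have hr1 : (P.cmax : ℤ) ≤ P.r 1 := by exact_mod_cast P.hcr 1
  have hcm0 : (0 : ℤ) ≤ P.cmax := by positivity
  rcases le_total |g1| |g0| with hle | hle
  · have hg : 1 ≤ |g0| := by
      rcases hne with ⟨j, hj⟩
      fin_cases j
      · exact Int.one_le_abs (sub_ne_zero.2 (Ne.symm hj))
      · exact le_trans (Int.one_le_abs (sub_ne_zero.2 (Ne.symm hj))) hle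
    refine ⟨0, ?_⟩
    have e : P.cenS v 0 - P.cenS u 0 = 20 * (P.r 0 : ℤ) * g0 + P.c 1 * g1 := by
      simp only [cenS_apply, h01, hg0, hg1]; ring
    rw [e]
    have h1 : |P.c 1 * g1| ≤ (P.cmax : ℤ) * |g0| := by
      rw [abs_mul]; exact mul_le_mul hc1 hle (abs_nonneg _) hcm0
    have h3 := abs_sub_abs_le_abs_sub (20 * (P.r 0 : ℤ) * g0) (-(P.c 1 * g1))
    rw [sub_neg_eq_add, abs_neg, abs_mul, abs_of_nonneg (by positivity : (0 : ℤ) ≤ 20 * (P.r 0 : ℤ))] at h3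
    nlinarith [abs_nonneg g0]
  · have hg : 1 ≤ |g1| := by
      rcases hne with ⟨j, hj⟩
      fin_cases j
      · exact le_trans (Int.one_le_abs (sub_ne_zero.2 (Ne.symm hj))) hle
      · exact Int.one_le_abs (sub_ne_zero.2 (Ne.symm hj))
    refine ⟨1, ?_⟩
    have e : P.cenS v 1 - P.cenS u 1 = 20 * (P.r 1 : ℤ) * g1 + P.c 0 * g0 := by
      simp only [cenS_apply, h10, hg0, hg1]; ring
    rw [e]
    have h1 : |P.c 0 * g0| ≤ (P.cmax : ℤ) * |g1| := by
      rw [abs_mul]; exact mul_le_mul hc0 hle (abs_nonneg _) hcm0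
    have h3 := abs_sub_abs_le_abs_sub (20 * (P.r 1 : ℤ) * g1) (-(P.c 0 * g0))
    rw [sub_neg_eq_add, abs_neg, abs_mul, abs_of_nonneg (by positivity : (0 : ℤ) ≤ 20 * (P.r 1 : ℤ))] at h3
    nlinarith [abs_nonneg g1]

/-- **Separation, usable form**: for `u ≠ v` some coordinate of the centres differs by at least `19 r_j`. [this work] -/
theorem cenS_sep' {u v : Site 2} (h : u ≠ v) : ∃ j : Fin 2, 19 * (P.r j : ℤ) ≤ |P.cenS v j - P.cenS u j| := by
  obtain ⟨j, hj⟩ := P.cenS_sep h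
  have : (P.cmax : ℤ) ≤ P.r j := by exact_mod_cast P.hcr j
  exact ⟨j, by linarith⟩

/-! ## §2 The boxes about the staggered centre (the intervals of `PlanarCells2Defs`, verbatim) -/

/-- `Q_v = cenS v + [−5r₀, 5r₀] × [−5r₁, 5r₁]`. [cite: KozmaNitzan2024, §4 p. 26 (Q_v)] -/
def Q (v : Site 2) : Finset (Site 2) := Finset.Icc (P.cenS v - P.hw 5) (P.cenS v + P.hw 5)

/-- `M_v = cenS v + [−3r₀, 3r₀] × [−3r₁, 3r₁]` (KN's cube; the (C) corridor's ARRIVAL box is the smaller parking box of the scheme, slots `bα, bβ`). [cite: KozmaNitzan2024, §4 p. 26 (M_v)] -/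
def M (v : Site 2) : Finset (Site 2) := Finset.Icc (P.cenS v - P.hw 3) (P.cenS v + P.hw 3)

/-- The cell `cenS v + [−10r₀, 10r₀] × [−10r₁, 10r₁]` (diagonal neighbours may share a `c 1 × c 0` corner — see the module docstring). [folklore] -/
def Cell (v : Site 2) : Finset (Site 2) := Finset.Icc (P.cenS v - P.hw 10) (P.cenS v + P.hw 10)

/-- The between-box `cenS v + {5r∥ < σ x_a < 15r∥} × [−5r⊥, 5r⊥]`. [cite: KozmaNitzan2024, §4 p. 26 (E_{v,x})] -/
def Btw (v : Site 2) (δ : MDir) : Finset (Site 2) :=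
  sBox δ.1 (sgOf δ) (P.cenS v) (5 * P.r δ.1 + 1) (15 * P.r δ.1 - 1) (5 * P.r (oth δ.1))

/-- `E^far_{v,x} = cenS v + {5r∥ < σ x_a ≤ 25r∥} × [−5r⊥, 5r⊥]`. [cite: KozmaNitzan2024, §4 p. 26 (E_{v,x})] -/
def Efar (v : Site 2) (δ : MDir) : Finset (Site 2) :=
  sBox δ.1 (sgOf δ) (P.cenS v) (5 * P.r δ.1 + 1) (25 * P.r δ.1) (5 * P.r (oth δ.1))

/-- `E_{v,x} = Btw ∪ Q_x` (the target's `Q` about the STAGGERED neighbour centre). [cite: KozmaNitzan2024, §4 p. 26 (E_{v,x})] -/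
def Ewv (v : Site 2) (δ : MDir) : Finset (Site 2) := P.Btw v δ ∪ P.Q (v + stepVec δ)

/-- The stub `H^j_{v,x} = cenS v + {5r∥ ≤ σ x_a ≤ 5r∥ + 10 s∥ j} × [−2r⊥, 2r⊥]`. [cite: KozmaNitzan2024, §4 p. 26 (H^j_{v,x})] -/
def Stub (v : Site 2) (δ : MDir) (j : ℕ) : Finset (Site 2) :=
  sBox δ.1 (sgOf δ) (P.cenS v) (5 * P.r δ.1) (5 * P.r δ.1 + 10 * P.s δ.1 * j) (2 * P.r (oth δ.1))

/-- The stub zone `cenS v + {10r∥ ≤ σ x_a ≤ 15r∥ − 10s∥} × [−2r⊥, 2r⊥]`. [cite: KozmaNitzan2024, §4 p. 26] -/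
def Zone (v : Site 2) (δ : MDir) : Finset (Site 2) :=
  sBox δ.1 (sgOf δ) (P.cenS v) (10 * P.r δ.1) (15 * P.r δ.1 - 10 * P.s δ.1) (2 * P.r (oth δ.1))

/-- The face `F^j_{v,x} = cenS v + {σ x_a = 5r∥ + 10s∥j} × [−2r⊥, 2r⊥]`. [cite: KozmaNitzan2024, §4 p. 30 (F^j_{v,x})] -/
def Face (v : Site 2) (δ : MDir) (j : ℕ) : Finset (Site 2) :=
  sBox δ.1 (sgOf δ) (P.cenS v) (5 * P.r δ.1 + 10 * P.s δ.1 * j) (5 * P.r δ.1 + 10 * P.s δ.1 * j) (2 * P.r (oth δ.1))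

/-- The full corridor `H_{v,x} = cenS v + {5r∥ ≤ σ x_a ≤ 22r∥} × [−2r⊥, 2r⊥]`. [cite: KozmaNitzan2024, §4 p. 26 (H_{v,x})] -/
def Hfull (v : Site 2) (δ : MDir) : Finset (Site 2) :=
  sBox δ.1 (sgOf δ) (P.cenS v) (5 * P.r δ.1) (22 * P.r δ.1) (2 * P.r (oth δ.1))

/-- The narrow between-box `cenS v + {5r∥ < σ x_a < 15r∥} × [−(5r⊥−1), 5r⊥−1]`. [cite: KozmaNitzan2024, §4 p. 26 (E_{v,x})] -/
def BtwN (v : Site 2) (δ : MDir) : Finset (Site 2) :=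
  sBox δ.1 (sgOf δ) (P.cenS v) (5 * P.r δ.1 + 1) (15 * P.r δ.1 - 1) (5 * P.r (oth δ.1) - 1)

/-- The narrow far region `cenS v + {5r∥ < σ x_a ≤ 25r∥} × [−(5r⊥−1), 5r⊥−1]`. [cite: KozmaNitzan2024, §4 p. 26 (E_{v,x})] -/
def EfarN (v : Site 2) (δ : MDir) : Finset (Site 2) :=
  sBox δ.1 (sgOf δ) (P.cenS v) (5 * P.r δ.1 + 1) (25 * P.r δ.1) (5 * P.r (oth δ.1) - 1)

/-- The narrow `E_{v,x} = BtwN ∪ Q_x`. [cite: KozmaNitzan2024, §4 p. 26 (E_{v,x})] -/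
def EwvN (v : Site 2) (δ : MDir) : Finset (Site 2) := P.BtwN v δ ∪ P.Q (v + stepVec δ)

/-- The narrow fresh rows above the stub of level `j`. [cite: KozmaNitzan2024, §4 p. 30] -/
def farAN (x : Site 2) (du : MDir) (j : ℕ) : Finset (Site 2) :=
  sBox du.1 (sgOf du) (P.cenS x) (5 * P.r du.1 + 10 * P.s du.1 * j + 1) (25 * P.r du.1) (5 * P.r (oth du.1) - 1)

/-- The shrunk far rows (one unit inside `farAN` on every side). [cite: KozmaNitzan2024, §4 p. 30 (the rows above H^j)] -/
def farAS (x : Site 2) (du : MDir) (j : ℕ) : Finset (Site 2) :=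
  sBox du.1 (sgOf du) (P.cenS x) (5 * P.r du.1 + 10 * P.s du.1 * j + 2) (25 * P.r du.1 - 1) (5 * P.r (oth du.1) - 2)

/-- The level of `t` along `δ` from `v`: `σ (t_a − cenS v_a)`. [cite: KozmaNitzan2024, §4 p. 30] -/
def lev (δ : MDir) (v : Site 2) (t : Site 2) : ℤ := sgOf δ * (t δ.1 - P.cenS v δ.1)

/-- Lower corner of the shifted face row about the staggered centre. [folklore] -/
def faceLo (x : Site 2) (du : MDir) (j : ℕ) : Site 2 := sLo du.1 (sgOf du) (P.cenS x) (P.faceL du.1 j) (P.faceL du.1 j) (2 * P.r (oth du.1))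

/-- Upper corner of the shifted face row about the staggered centre. [folklore] -/
def faceHi (x : Site 2) (du : MDir) (j : ℕ) : Site 2 := sHi du.1 (sgOf du) (P.cenS x) (P.faceL du.1 j) (P.faceL du.1 j) (2 * P.r (oth du.1))

/-- The narrow planar world of the probe `v → v+δ → v+δ+du` about staggered centres (the target's cube and corridor move with the staggered
neighbour `v + δ`). [cite: KozmaNitzan2024, §4 p. 26 (E_{v,x}, H_{x,y})] -/
def probeWorldN (v : Site 2) (δ du : MDir) : Finset (Site 2) := P.BtwN v δ ∪ P.Q (v + stepVec δ) ∪ P.Hfull (v + stepVec δ) du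

/-! ### Membership -/

/-- Membership in a staggered-centred anisotropic box of half-widths `(n r₀, n r₁)`. [folklore] -/
theorem mem_aboxS_iff {v : Site 2} {n : ℕ} {t : Site 2} :
    t ∈ Finset.Icc (P.cenS v - P.hw n) (P.cenS v + P.hw n) ↔ ∀ i, P.cenS v i - (n * P.r i : ℕ) ≤ t i ∧ t i ≤ P.cenS v i + (n * P.r i : ℕ) := by
  rw [mem_Icc_iff]
  refine forall_congr' fun i => ?_
  simp only [Pi.sub_apply, Pi.add_apply, PCells2.hw_apply]

/-- The shifted face row about the staggered centre as a signed box. [folklore] -/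
theorem Icc_faceLo_faceHi (x : Site 2) (du : MDir) (j : ℕ) :
    Finset.Icc (P.faceLo x du j) (P.faceHi x du j) = sBox du.1 (sgOf du) (P.cenS x) (P.faceL du.1 j) (P.faceL du.1 j) (2 * P.r (oth du.1)) := rfl

/-- The centre lies in its own `Q`, `M` and `Cell`. [folklore] -/
theorem cenS_mem (v : Site 2) : P.cenS v ∈ P.Q v ∧ P.cenS v ∈ P.M v ∧ P.cenS v ∈ P.Cell v := by
  simp only [Q, M, Cell, mem_aboxS_iff]
  refine ⟨fun i => ⟨?_, ?_⟩, fun i => ⟨?_, ?_⟩, fun i => ⟨?_, ?_⟩⟩ <;> simp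

end PCells2S

end Transplant

end Summit.CriticalPhenomena.PercolationContinuityZ3.Theorems

end
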